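import Summits.CriticalPhenomena.PercolationContinuityZ3.Theorems.PercNearOneGluingNoHeavyLowerTailSunflowerLeafLeafFreeCross
import HarnessLib

/-!
# `NoHeavyLowerTail` (crux stmt-CriticalPhenomena-4575), abstract sunflower cubic: the leaf-leaf lemma at a parameter point from
# `CrossIneq` at that point (assembly of the gen-67 chain)

Support file (seat `prim-ineq-prove-1` gen 67; `--supports stmt-CriticalPhenomena-4575`).  No `sorry`, no named facts, no new definitions.
Memo: run/shared/lean/prim/prim-ineq-prove-1/FINDING-FREEFOUR-prove1-g67.md §2.

`leafLeaf_of_freeFour_graph` (…LeafLeafFree) + `freeFour_of_cross` (…LeafLeafFreeCross): for `Γ₀` with `z₁, z₂` isolated and an A-safe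
core, and a parameter point `p` at which the floor `μ_p(edgeCore Γ₀ | u, w closed)` is positive, the core of `Γ₀ + z₁u + z₂w + z₁z₂` is
safe at `p` as soon as `CrossIneq` holds at `(p_u, p_w, p_{z₁})` and the four `(u,w)`-section measures of `edgeCore Γ₀`.  The floor
inequalities `α₀₀ ≤ α₀₁, α₁₀ ≤ α₁₁ ≤ 1` needed by the analytic side are automatic (sections of an up-set).
* **`leafLeaf_of_cross_graph`**.
-/

noncomputable section

namespace Summit.CriticalPhenomena.PercolationContinuityZ3.Theorems.SunflowerPartition

namespace SafeCalc

open MeasureTheory Finset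
open Literature.Probability.LatticeModels Literature.Probability.Percolation
open RelLemmaA UnionEdge LeafLeafZ

variable {ι : Type*} [Fintype ι] [DecidableEq ι] (p : ι → unitInterval)

/-- **The leaf-leaf lemma at `p` from `CrossIneq` at `p`** (graph form; floor `μ_p(edgeCore Γ₀ | u,w closed) > 0`). [this work] -/
theorem leafLeaf_of_cross_graph (Γ₀ : SimpleGraph ι) {z₁ z₂ u w : ι} (h12 : z₁ ≠ z₂) (h1u : z₁ ≠ u) (h1w : z₁ ≠ w)
    (h2u : z₂ ≠ u) (h2w : z₂ ≠ w) (huw : u ≠ w) (hz₁ : ∀ x, ¬ Γ₀.Adj z₁ x) (hz₂ : ∀ x, ¬ Γ₀.Adj z₂ x)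
    (hsafe : ∀ q : ι → unitInterval, Safe q (edgeCore Γ₀))
    (hpos : 0 < (prodBernoulli p).real (secOff w (secOff u (edgeCore Γ₀))))
    (hX : CrossIneq (p u) (p w) (p z₁)
      ((prodBernoulli p).real (secOff w (secOff u (edgeCore Γ₀)))) ((prodBernoulli p).real (secOn w (secOff u (edgeCore Γ₀))))
      ((prodBernoulli p).real (secOff w (secOn u (edgeCore Γ₀)))) ((prodBernoulli p).real (secOn w (secOn u (edgeCore Γ₀))))) :
    Safe p (edgeCore (Γ₀ ⊔ SimpleGraph.fromEdgeSet {s(z₁, u)} ⊔ SimpleGraph.fromEdgeSet {s(z₂, w)} ⊔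
      SimpleGraph.fromEdgeSet {s(z₁, z₂)})) := by
  have hA : IsUpperSet (edgeCore Γ₀) := isUpperSet_edgeCore Γ₀
  have h01 : (prodBernoulli p).real (secOff w (secOff u (edgeCore Γ₀))) ≤ (prodBernoulli p).real (secOn w (secOff u (edgeCore Γ₀))) :=
    measureReal_mono (secOff_subset_secOn w (isUpperSet_secOff u hA))
  have h10 : (prodBernoulli p).real (secOff w (secOff u (edgeCore Γ₀))) ≤ (prodBernoulli p).real (secOff w (secOn u (edgeCore Γ₀))) :=
    measureReal_mono (secOff_mono w (secOff_subset_secOn u hA))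
  have h0111 : (prodBernoulli p).real (secOn w (secOff u (edgeCore Γ₀))) ≤ (prodBernoulli p).real (secOn w (secOn u (edgeCore Γ₀))) :=
    measureReal_mono (secOn_mono w (secOff_subset_secOn u hA))
  have h1011 : (prodBernoulli p).real (secOff w (secOn u (edgeCore Γ₀))) ≤ (prodBernoulli p).real (secOn w (secOn u (edgeCore Γ₀))) :=
    measureReal_mono (secOff_subset_secOn w (isUpperSet_secOn u hA))
  have h11 : (prodBernoulli p).real (secOn w (secOn u (edgeCore Γ₀))) ≤ 1 := measureReal_le_one
  exact leafLeaf_of_freeFour_graph p Γ₀ h12 h1u h1w h2u h2w huw hz₁ hz₂ hsafe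
    (freeFour_of_cross (p u).2.1 (p u).2.2 (p w).2.1 (p w).2.2 (p z₁).2.1 (p z₁).2.2 (p z₂).2.1 (p z₂).2.2 hpos h01 h10 h0111
      h1011 h11 hX)

end SafeCalc

end Summit.CriticalPhenomena.PercolationContinuityZ3.Theorems.SunflowerPartition
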